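import Summits.Ventures.LatticeQCDFlow.Scoring.SUNOnePlaquetteHaarMGF
import HarnessLib

/-!
# Weyl's formula for the class function `(N − Re tr U) e^{x Re tr U}` on `SU(N)`, in the free eigen-phases

HONEST FRAMING: exact (Metropolis-corrected) sampling algorithms for lattice gauge theory;
figures of merit are autocorrelation/cost numbers at stated couplings and volumes; no
continuum-physics claim.

Venture `LatticeQCDFlow` (cell pub-lqcd), sub-topic `Scoring`; FANOUT row 5 (`s0-sun-a`), GEN-20.
NEW WORK of the cell (placement rule).  Part 1 of the one-loop law of the `SU(N)` plaquette
(`PlaquetteWeakCouplingSU`): GEN-17's two-step Weyl reduction (`SU(N)` → `SΔ(N)` → the free cube `(−π,π]^{N−1}`,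
`φ_0 = −Σψ`) applied to the numerator class function `(N − Re tr U) e^{x Re tr U}` of `1 − P_N`:

* `weylDensity_mul_weight_diagonal`, `continuous_cube_weighted_su`, `integrable_cube_weighted_su`;
* **`integral_haar_specialUnitaryGroup_sub_trace_mul_exp`** —
  `∫_{SU(N)} (N − Re tr U) e^{x Re tr U} dU = ((2π)^{N−1} N!)⁻¹ ∫ (Σ_b (1 − cos φ_b(θ))) e^{xΣ_b cos φ_b(θ)} Π_{j≺k}|e^{iφ_j(θ)} − e^{iφ_k(θ)}|² dθ`.

No `def`, nothing cited as a fact, 0 sorry.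
-/

noncomputable section

open Real MeasureTheory Filter Topology Finset
open scoped ENNReal
open Complex (I)
open Literature.MathematicalPhysics.QuantumFieldTheory (haarProbability)
open Literature.RepresentationTheory.CompactGroups
open Literature.RepresentationTheory.CompactGroups.WeylIntegration
open Literature.LinearAlgebra.Matrix (specialDiagonalTorus)

namespace Summit.Ventures.LatticeQCDFlow.Scoring

/-! ### 1. Weyl's formula for `(N − Re tr U) e^{x Re tr U}` on `SU(N)` -/

/-- The weighted Weyl density at a diagonal point of the `SU(N)` torus, in the free phases. -/
theorem weylDensity_mul_weight_diagonal (N : ℕ) (x : ℝ) (φ : Fin N → ℝ) :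
    (∏ i, ∏ j ∈ Finset.univ.erase i,
        ‖(Matrix.diagonal fun i : Fin N => Complex.exp ((φ i : ℂ) * I)) i i -
          (Matrix.diagonal fun i : Fin N => Complex.exp ((φ i : ℂ) * I)) j j‖) / (N.factorial : ℝ) *
        ((N - (Matrix.diagonal fun i : Fin N => Complex.exp ((φ i : ℂ) * I)).trace.re) *
          Real.exp (x * (Matrix.diagonal fun i : Fin N => Complex.exp ((φ i : ℂ) * I)).trace.re))
      = ((∑ b, (1 - Real.cos (φ b))) * (Real.exp (x * ∑ b, Real.cos (φ b)) *
          ∏ p : OD (Fin N), ‖Complex.exp (φ p.1.1 * I) - Complex.exp (φ p.1.2 * I)‖ ^ 2)) / (N.factorial : ℝ) := by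
  rw [← coe_torusPt, prod_offDiag_norm_sub_torusPt, trace_re_torusPt]
  have hsum : ((N : ℝ) - ∑ b, Real.cos (φ b)) = ∑ b, (1 - Real.cos (φ b)) := by
    rw [Finset.sum_sub_distrib, Finset.sum_const, Finset.card_univ, Fintype.card_fin, nsmul_eq_mul, mul_one]
  rw [hsum]
  ring

/-- The weighted torus integrand on the free cube is continuous. -/
theorem continuous_cube_weighted_su (N : ℕ) [NeZero N] (x : ℝ) :
    Continuous (fun θ : {i : Fin N // i ≠ 0} → ℝ =>
      (∑ b : Fin N, (1 - Real.cos (if h : b = 0 then -∑ k, θ k else θ ⟨b, h⟩))) *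
        (Real.exp (x * ∑ b : Fin N, Real.cos (if h : b = 0 then -∑ k, θ k else θ ⟨b, h⟩)) *
          ∏ p : OD (Fin N), ‖Complex.exp (((if h : p.1.1 = 0 then -∑ k, θ k else θ ⟨p.1.1, h⟩ : ℝ) : ℂ) * I) -
            Complex.exp (((if h : p.1.2 = 0 then -∑ k, θ k else θ ⟨p.1.2, h⟩ : ℝ) : ℂ) * I)‖ ^ 2)) := by
  refine (continuous_finsetSum _ fun b _ => continuous_const.sub (Real.continuous_cos.comp
    (continuous_ext_apply 0 b))).mul ((Real.continuous_exp.comp (continuous_const.mul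
      (continuous_finsetSum _ fun b _ => Real.continuous_cos.comp (continuous_ext_apply 0 b)))).mul
        (continuous_finsetProd _ fun p _ => ?_))
  exact (((Complex.continuous_ofReal.comp (continuous_ext_apply 0 _)).mul continuous_const).cexp.sub
    ((Complex.continuous_ofReal.comp (continuous_ext_apply 0 _)).mul continuous_const).cexp).norm.pow 2

/-- The weighted torus integrand on the free cube is integrable. -/
theorem integrable_cube_weighted_su (N : ℕ) [NeZero N] (x : ℝ) :
    Integrable (fun θ : {i : Fin N // i ≠ 0} → ℝ =>
      (∑ b : Fin N, (1 - Real.cos (if h : b = 0 then -∑ k, θ k else θ ⟨b, h⟩))) *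
        (Real.exp (x * ∑ b : Fin N, Real.cos (if h : b = 0 then -∑ k, θ k else θ ⟨b, h⟩)) *
          ∏ p : OD (Fin N), ‖Complex.exp (((if h : p.1.1 = 0 then -∑ k, θ k else θ ⟨p.1.1, h⟩ : ℝ) : ℂ) * I) -
            Complex.exp (((if h : p.1.2 = 0 then -∑ k, θ k else θ ⟨p.1.2, h⟩ : ℝ) : ℂ) * I)‖ ^ 2))
      (Measure.pi fun _ : {i : Fin N // i ≠ 0} => (volume : Measure ℝ).restrict (Set.Ioc (-π) π)) := by
  have h := integrable_cube_exp_mul_sum_cos_mul_prod_norm_sub_sq_ext (n := Fin N) 0 x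
  refine (h.const_mul (2 * N)).mono' (continuous_cube_weighted_su N x).aestronglyMeasurable
    (Eventually.of_forall fun θ => ?_)
  have hF0 : 0 ≤ Real.exp (x * ∑ b : Fin N, Real.cos (if h : b = 0 then -∑ k, θ k else θ ⟨b, h⟩)) *
      ∏ p : OD (Fin N), ‖Complex.exp (((if h : p.1.1 = 0 then -∑ k, θ k else θ ⟨p.1.1, h⟩ : ℝ) : ℂ) * I) -
        Complex.exp (((if h : p.1.2 = 0 then -∑ k, θ k else θ ⟨p.1.2, h⟩ : ℝ) : ℂ) * I)‖ ^ 2 :=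
    mul_nonneg (Real.exp_nonneg _) (Finset.prod_nonneg fun p _ => sq_nonneg _)
  have hS0 : 0 ≤ ∑ b : Fin N, (1 - Real.cos (if h : b = 0 then -∑ k, θ k else θ ⟨b, h⟩)) :=
    Finset.sum_nonneg fun b _ => by linarith [Real.cos_le_one (if h : b = 0 then -∑ k, θ k else θ ⟨b, h⟩)]
  have hS : ∑ b : Fin N, (1 - Real.cos (if h : b = 0 then -∑ k, θ k else θ ⟨b, h⟩)) ≤ 2 * N := by
    calc ∑ b : Fin N, (1 - Real.cos (if h : b = 0 then -∑ k, θ k else θ ⟨b, h⟩)) ≤ ∑ _b : Fin N, (2 : ℝ) :=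
          Finset.sum_le_sum fun b _ => by linarith [Real.neg_one_le_cos (if h : b = 0 then -∑ k, θ k else θ ⟨b, h⟩)]
      _ = 2 * N := by simp [mul_comm]
  rw [Real.norm_eq_abs, abs_of_nonneg (mul_nonneg hS0 hF0)]
  exact mul_le_mul_of_nonneg_right hS hF0

/-- **Weyl's formula for the class function `(N − Re tr U) e^{x Re tr U}` on `SU(N)`** (`N ≥ 1`, free phases `k ≠ 0`):
`∫_{SU(N)} (N − Re tr U) e^{x Re tr U} dU = ((2π)^{N−1} N!)⁻¹ ∫ (Σ_b(1 − cos φ_b(θ))) e^{xΣcos φ_b(θ)} Π|e^{iφ_j} − e^{iφ_k}|² dθ`. -/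
theorem integral_haar_specialUnitaryGroup_sub_trace_mul_exp (N : ℕ) [NeZero N] (x : ℝ) :
    ∫ u, (((N : ℝ) - ((u : Matrix.specialUnitaryGroup (Fin N) ℂ) : Matrix (Fin N) (Fin N) ℂ).trace.re) *
        Real.exp (x * ((u : Matrix.specialUnitaryGroup (Fin N) ℂ) : Matrix (Fin N) (Fin N) ℂ).trace.re))
        ∂(haarProbability (Matrix.specialUnitaryGroup (Fin N) ℂ))
      = ((2 * π) ^ (N - 1) * N.factorial)⁻¹ *
        ∫ θ : {i : Fin N // i ≠ 0} → ℝ,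
          (∑ b : Fin N, (1 - Real.cos (if h : b = 0 then -∑ k, θ k else θ ⟨b, h⟩))) *
            (Real.exp (x * ∑ b : Fin N, Real.cos (if h : b = 0 then -∑ k, θ k else θ ⟨b, h⟩)) *
              ∏ p : OD (Fin N), ‖Complex.exp (((if h : p.1.1 = 0 then -∑ k, θ k else θ ⟨p.1.1, h⟩ : ℝ) : ℂ) * I) -
                Complex.exp (((if h : p.1.2 = 0 then -∑ k, θ k else θ ⟨p.1.2, h⟩ : ℝ) : ℂ) * I)‖ ^ 2)
          ∂(Measure.pi fun _ : {i : Fin N // i ≠ 0} => (volume : Measure ℝ).restrict (Set.Ioc (-π) π)) := by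
  have htr : Continuous fun u : Matrix.specialUnitaryGroup (Fin N) ℂ =>
      ((u : Matrix.specialUnitaryGroup (Fin N) ℂ) : Matrix (Fin N) (Fin N) ℂ).trace.re :=
    Complex.continuous_re.comp (continuous_id.matrix_trace.comp continuous_subtype_val)
  have hc : Continuous fun u : Matrix.specialUnitaryGroup (Fin N) ℂ =>
      (((N : ℝ) - ((u : Matrix.specialUnitaryGroup (Fin N) ℂ) : Matrix (Fin N) (Fin N) ℂ).trace.re) *
        Real.exp (x * ((u : Matrix.specialUnitaryGroup (Fin N) ℂ) : Matrix (Fin N) (Fin N) ℂ).trace.re)) :=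
    (continuous_const.sub htr).mul (Real.continuous_exp.comp (continuous_const.mul htr))
  have hG0 : ∀ u : Matrix.specialUnitaryGroup (Fin N) ℂ, 0 ≤ (((N : ℝ) - ((u : Matrix.specialUnitaryGroup (Fin N) ℂ) :
      Matrix (Fin N) (Fin N) ℂ).trace.re) * Real.exp (x * ((u : Matrix.specialUnitaryGroup (Fin N) ℂ) :
        Matrix (Fin N) (Fin N) ℂ).trace.re)) := fun u => by
    have h := abs_trace_re_le_card_su u
    rw [Fintype.card_fin] at h
    exact mul_nonneg (by linarith [(abs_le.1 h).2]) (Real.exp_nonneg _)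
  have hF : Measurable fun u : Matrix.specialUnitaryGroup (Fin N) ℂ => ENNReal.ofReal
      ((((N : ℝ) - ((u : Matrix.specialUnitaryGroup (Fin N) ℂ) : Matrix (Fin N) (Fin N) ℂ).trace.re) *
        Real.exp (x * ((u : Matrix.specialUnitaryGroup (Fin N) ℂ) : Matrix (Fin N) (Fin N) ℂ).trace.re))) :=
    ENNReal.measurable_ofReal.comp hc.measurable
  have hcl : ∀ g u : Matrix.specialUnitaryGroup (Fin N) ℂ, ENNReal.ofReal
      ((((N : ℝ) - (((g * u * g⁻¹ : Matrix.specialUnitaryGroup (Fin N) ℂ)) : Matrix (Fin N) (Fin N) ℂ).trace.re) *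
        Real.exp (x * (((g * u * g⁻¹ : Matrix.specialUnitaryGroup (Fin N) ℂ)) : Matrix (Fin N) (Fin N) ℂ).trace.re)))
      = ENNReal.ofReal ((((N : ℝ) - ((u : Matrix.specialUnitaryGroup (Fin N) ℂ) : Matrix (Fin N) (Fin N) ℂ).trace.re) *
        Real.exp (x * ((u : Matrix.specialUnitaryGroup (Fin N) ℂ) : Matrix (Fin N) (Fin N) ℂ).trace.re))) := by
    intro g u
    rw [trace_conj_specialUnitaryGroup]
  -- the density on the torus
  set H : Matrix (Fin N) (Fin N) ℂ → ℝ := fun M =>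
    (∏ i, ∏ j ∈ Finset.univ.erase i, ‖M i i - M j j‖) / (N.factorial : ℝ) *
      (((N : ℝ) - M.trace.re) * Real.exp (x * M.trace.re)) with hH
  have hHc : Continuous H := by
    refine ((continuous_finsetProd _ fun i _ => continuous_finsetProd _ fun j _ => ?_).div_const _).mul
      ((continuous_const.sub (Complex.continuous_re.comp continuous_id.matrix_trace)).mul
        (Real.continuous_exp.comp (continuous_const.mul (Complex.continuous_re.comp continuous_id.matrix_trace))))
    exact ((continuous_apply_apply i i).sub (continuous_apply_apply j j)).norm
  have hHnn : ∀ t : specialDiagonalTorus (Fin N),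
      0 ≤ H (((t : Matrix.specialUnitaryGroup (Fin N) ℂ)) : Matrix (Fin N) (Fin N) ℂ) := fun t =>
    mul_nonneg (div_nonneg (Finset.prod_nonneg fun i _ => Finset.prod_nonneg fun j _ => norm_nonneg _)
      (Nat.cast_nonneg _)) (hG0 _)
  have hW : ∀ t : specialDiagonalTorus (Fin N),
      weylWeightSU t * ENNReal.ofReal ((((N : ℝ) - (((t : Matrix.specialUnitaryGroup (Fin N) ℂ)) :
        Matrix (Fin N) (Fin N) ℂ).trace.re) * Real.exp (x * (((t : Matrix.specialUnitaryGroup (Fin N) ℂ)) :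
          Matrix (Fin N) (Fin N) ℂ).trace.re)))
        = ENNReal.ofReal (H (((t : Matrix.specialUnitaryGroup (Fin N) ℂ)) : Matrix (Fin N) (Fin N) ℂ)) := by
    intro t
    rw [weylWeightSU, ← ENNReal.ofReal_mul (div_nonneg (Finset.prod_nonneg fun i _ =>
      Finset.prod_nonneg fun j _ => norm_nonneg _) (Nat.cast_nonneg _))]
    simp only [hH, Fintype.card_fin]
  have hHt : Continuous fun t : specialDiagonalTorus (Fin N) =>
      H (((t : Matrix.specialUnitaryGroup (Fin N) ℂ)) : Matrix (Fin N) (Fin N) ℂ) :=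
    hHc.comp (continuous_subtype_val.comp continuous_subtype_val)
  rw [integral_eq_lintegral_of_nonneg_ae (Eventually.of_forall hG0) hc.aestronglyMeasurable,
    lintegral_haarProbability_specialUnitaryGroup_eq_lintegral_specialDiagonalTorus hF hcl]
  simp_rw [hW]
  rw [← integral_eq_lintegral_of_nonneg_ae (Eventually.of_forall hHnn) hHt.aestronglyMeasurable,
    integral_haar_specialDiagonalTorus_eq_integral_cube 0 H hHc]
  simp only [hH]
  simp_rw [weylDensity_mul_weight_diagonal]
  rw [integral_div]
  have hπ : (2 * π : ℝ) ≠ 0 := by positivity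
  have hN : (N.factorial : ℝ) ≠ 0 := Nat.cast_ne_zero.2 (Nat.factorial_ne_zero _)
  have hm : Fintype.card {i : Fin N // i ≠ 0} = N - 1 := by simp [Fintype.card_subtype_compl]
  rw [hm, inv_pow, mul_inv]
  set J : ℝ := ∫ θ : {i : Fin N // i ≠ 0} → ℝ,
          (∑ b : Fin N, (1 - Real.cos (if h : b = 0 then -∑ k, θ k else θ ⟨b, h⟩))) *
            (Real.exp (x * ∑ b : Fin N, Real.cos (if h : b = 0 then -∑ k, θ k else θ ⟨b, h⟩)) *
              ∏ p : OD (Fin N), ‖Complex.exp (((if h : p.1.1 = 0 then -∑ k, θ k else θ ⟨p.1.1, h⟩ : ℝ) : ℂ) * I) -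
                Complex.exp (((if h : p.1.2 = 0 then -∑ k, θ k else θ ⟨p.1.2, h⟩ : ℝ) : ℂ) * I)‖ ^ 2)
          ∂(Measure.pi fun _ : {i : Fin N // i ≠ 0} => (volume : Measure ℝ).restrict (Set.Ioc (-π) π)) with hJ
  field_simp

end Summit.Ventures.LatticeQCDFlow.Scoring
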